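import Summits.KontsevichZagierPeriods.Zeta5Search.WedgeDictionaryThreeTerm
import Summits.KontsevichZagierPeriods.Zeta5Search.WedgeDictionaryBridge
import Summits.KontsevichZagierPeriods.Zeta5Search.WedgeDictionaryKernelCellsBridgeKernel

/-!
# (H1)-free NATIVE cellular relation `bridge` with symbolic parameters, from F1 + F2 (cell `pub-zeta5`, lineage gen-1, g21/g22)

HONEST FRAMING: systematic search; no irrationality claim unless certified.  Structure of gen-1's OPEN dictionary node
`WedgeDictionary.explicitPQ` only; nothing about linear forms or ζ(5); nothing is evaluated.  PROVED, for SYMBOLIC `a : Fin 8 → ℤ`: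
`cellBridge_native` — the conclusion of the tree node `CellBridge` (`WedgeDictionaryBridge.lean`) at `a`:
`FourTermRel (bridgeBase (bOfA a)) (bridgeSlot (bOfA a)) (bridgeHalf (bOfA a)) (bridgeApex (bOfA a)) a (a - slotDown 7) (a + halfUp457) (a + dsUp)`;
four family kernels plus FOUR virtual 12-parameter points `v₀ = (p₀,p₁,p₂,p₃+1,p₄,p₅+1,p₆+1; q₁+1,q₂,q₃,q₄+1,q₅)`, `v₁ = v₀ + e_{p₃}`,
`v₂ = v₀ + e_{p₄} − e_{q₄}`, `v₃ = v₁ + e_{p₄} − e_{q₄}` (letters of `a`), each entering twice (opposite coefficients, contour shifts `(0,0)` and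
`(0,1)`), which cancel in the conclusion.  This is the Mellin–Barnes form of g15's one-term creative-telescoping certificate
(`WedgeDictionaryBridgeCertificate.lean`, `C_t = t·Q(s,t)·R_a/((s+p₁+q₁+2)(t+p₄))`: the quadratic `Q` does not factor, hence four virtual points,
found by an exact dictionary solve `code/gen1/g21/bridgedict.py` and fitted exactly by `bridgefit4.py`).  All kernel coefficients carry the common
factor `q₁+1 = a 3 + 1 > 0`, divided out at the end.
Hypotheses: F1 (`cellularIntegral_eq_cubicalIntegral`, `cubicalIntegral_eq_Jintegral`), F2 (`barnes_double`), `Converges` of the four members and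
`ChamberQ (pOf x) (qOf x) c₁ c₂` of the four members at ONE rational `(c₁,c₂)` (decidable per instance; the virtual chambers follow from these).
Proof: the pointwise kernel identity `kernel_bridge` (Γ-functional-equation algebra; generated and exactly self-checked by `code/gen1/g22/bridgegen2.py`
over g21's `bridgegen.py` + `cellgen.py`) fed to `KernelCells.jsum_of_kernel` (`WedgeDictionaryKernelCells.lean`), then F1 and the prefactor in Γ-form.  No (H1), no invariance
group; the bookkeeping to the `@[conjecture]` node itself (hypotheses `RegionHyp`; a common chamber point needs `b₆ ≥ 1` and
`max(b₃,b₄,b₅) + max(b₁,b₂,b₇+1) ≤ N − 1`, memo D2-CELLULAR-g20.md §3) is NOT done here.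
-/

set_option maxHeartbeats 8000000
set_option linter.unusedSimpArgs false
set_option linter.unusedTactic false
set_option linter.unreachableTactic false
set_option linter.unnecessarySeqFocus false
set_option linter.style.longLine false
set_option linter.unusedVariables false

namespace Summit.KontsevichZagierPeriods.Zeta5Search.WedgeDictionary.KernelCells

open Literature.NumberTheory.Irrationality.BrownZudilin2022 MeasureTheory
open Summit.KontsevichZagierPeriods.Zeta5Search.WedgeDictionary.Kernel


/-- **Native BRIDGE** from F1 + F2 alone, for SYMBOLIC parameters: if the four family points converge and share a rational chamber
point `(c₁,c₂)`, the `CellBridge` relation holds among their cellular integrals. -/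
theorem cellBridge_native
    (h8 : cellularIntegral_eq_cubicalIntegral) (h10 : cubicalIntegral_eq_Jintegral) (hF2 : barnes_double)
    (a : Fin 8 → ℤ) (c₁ c₂ : ℚ) (hc0 : Converges a) (hc1 : Converges (a - slotDown 7)) (hc2 : Converges (a + halfUp457)) (hc3 : Converges (a + dsUp))
    (hch0 : ChamberQ (pOf a) (qOf a) c₁ c₂)
    (hch1 : ChamberQ (pOf (a - slotDown 7)) (qOf (a - slotDown 7)) c₁ c₂)
    (hch2 : ChamberQ (pOf (a + halfUp457)) (qOf (a + halfUp457)) c₁ c₂)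
    (hch3 : ChamberQ (pOf (a + dsUp)) (qOf (a + dsUp)) c₁ c₂) :
    FourTermRel (bridgeBase (bOfA a)) (bridgeSlot (bOfA a)) (bridgeHalf (bOfA a)) (bridgeApex (bOfA a)) a (a - slotDown 7) (a + halfUp457) (a + dsUp) := by
  have n0 := letters_nonneg hc0 hch0
  have eP0 : pOf a = ![a 4 + a 5 - a 7, a 1 + a 2 - a 3 + a 5 - a 7, a 5, a 1 + a 2 + a 5 - a 7, a 6, a 2 + a 5 - a 7, a 0 + a 1 - a 3 + a 5 - a 7] := by ext j; fin_cases j <;> simp [pOf] <;> omega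
  have eQ0 : qOf a = ![a 3, a 4, a 0 - a 2 + a 4, a 0, a 1] := by ext j; fin_cases j <;> simp [qOf] <;> omega
  rw [eP0, eQ0] at hch0 n0
  have n1 := letters_nonneg hc1 hch1
  have eP1 : pOf (a - slotDown 7) = ![a 4 + a 5 - a 7, a 1 + a 2 - a 3 + a 5 - a 7, a 5, a 1 + a 2 + a 5 - a 7, a 6 - 1, a 2 + a 5 - a 7, a 0 + a 1 - a 3 + a 5 - a 7] := by
    ext j; fin_cases j <;> simp only [pOf, Pi.add_apply, Pi.sub_apply] <;> simp [slotDown, dsUp, halfUp457] <;> omega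
  have eQ1 : qOf (a - slotDown 7) = ![a 3, a 4, a 0 - a 2 + a 4, a 0, a 1] := by
    ext j; fin_cases j <;> simp only [qOf, Pi.add_apply, Pi.sub_apply] <;> simp [slotDown, dsUp, halfUp457] <;> omega
  rw [eP1, eQ1] at hch1 n1
  have n2 := letters_nonneg hc2 hch2
  have eP2 : pOf (a + halfUp457) = ![a 4 + a 5 - a 7, a 1 + a 2 - a 3 + a 5 - a 7 + 1, a 5, a 1 + a 2 + a 5 - a 7 + 1, a 6, a 2 + a 5 - a 7 + 1, a 0 + a 1 - a 3 + a 5 - a 7 + 1] := by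
    ext j; fin_cases j <;> simp only [pOf, Pi.add_apply, Pi.sub_apply] <;> simp [slotDown, dsUp, halfUp457] <;> omega
  have eQ2 : qOf (a + halfUp457) = ![a 3, a 4, a 0 - a 2 + a 4, a 0 + 1, a 1] := by
    ext j; fin_cases j <;> simp only [qOf, Pi.add_apply, Pi.sub_apply] <;> simp [slotDown, dsUp, halfUp457] <;> omega
  rw [eP2, eQ2] at hch2 n2
  have n3 := letters_nonneg hc3 hch3
  have eP3 : pOf (a + dsUp) = ![a 4 + a 5 - a 7, a 1 + a 2 - a 3 + a 5 - a 7, a 5, a 1 + a 2 + a 5 - a 7 + 1, a 6, a 2 + a 5 - a 7, a 0 + a 1 - a 3 + a 5 - a 7] := by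
    ext j; fin_cases j <;> simp only [pOf, Pi.add_apply, Pi.sub_apply] <;> simp [slotDown, dsUp, halfUp457] <;> omega
  have eQ3 : qOf (a + dsUp) = ![a 3 + 1, a 4, a 0 - a 2 + a 4, a 0, a 1 + 1] := by
    ext j; fin_cases j <;> simp only [qOf, Pi.add_apply, Pi.sub_apply] <;> simp [slotDown, dsUp, halfUp457] <;> omega
  rw [eP3, eQ3] at hch3 n3
  have Z0 : 0 ≤ a 4 + a 5 - a 7 := by have h := n0.1 0; simp at h; omega
  have Z1 : 0 ≤ a 1 + a 2 - a 3 + a 5 - a 7 := by have h := n0.1 1; simp at h; omega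
  have Z2 : 0 ≤ a 5 := by have h := n0.1 2; simp at h; omega
  have Z3 : 0 ≤ a 1 + a 2 + a 5 - a 7 := by have h := n0.1 3; simp at h; omega
  have Z4 : 0 ≤ a 6 := by have h := n0.1 4; simp at h; omega
  have Z5 : 0 ≤ a 2 + a 5 - a 7 := by have h := n0.1 5; simp at h; omega
  have Z6 : 0 ≤ a 0 + a 1 - a 3 + a 5 - a 7 := by have h := n0.1 6; simp at h; omega
  have Z7 : 0 ≤ a 3 := by have h := n0.2 0; simp at h; omega
  have Z8 : 0 ≤ a 4 := by have h := n0.2 1; simp at h; omega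
  have Z9 : 0 ≤ a 0 - a 2 + a 4 := by have h := n0.2 2; simp at h; omega
  have Z10 : 0 ≤ a 0 := by have h := n0.2 3; simp at h; omega
  have Z11 : 0 ≤ a 1 := by have h := n0.2 4; simp at h; omega
  have Z12 : 0 ≤ a 6 - 1 := by have h := n1.1 4; simp at h; omega
  have Z13 : 0 ≤ a 1 + a 2 - a 3 + a 5 - a 7 + 1 := by have h := n2.1 1; simp at h; omega
  have Z14 : 0 ≤ a 1 + a 2 + a 5 - a 7 + 1 := by have h := n2.1 3; simp at h; omega
  have Z15 : 0 ≤ a 2 + a 5 - a 7 + 1 := by have h := n2.1 5; simp at h; omega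
  have Z16 : 0 ≤ a 0 + a 1 - a 3 + a 5 - a 7 + 1 := by have h := n2.1 6; simp at h; omega
  have Z17 : 0 ≤ a 0 + 1 := by have h := n2.2 3; simp at h; omega
  have Z18 : 0 ≤ a 3 + 1 := by have h := n3.2 0; simp at h; omega
  have Z19 : 0 ≤ a 1 + 1 := by have h := n3.2 4; simp at h; omega
  have Zq0 : (0 : ℚ) ≤ (a 4 : ℚ) + (a 5 : ℚ) - (a 7 : ℚ) := by exact_mod_cast Z0
  have Zr0 : (0 : ℝ) ≤ (a 4 : ℝ) + (a 5 : ℝ) - (a 7 : ℝ) := by exact_mod_cast Z0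
  have Zq1 : (0 : ℚ) ≤ (a 1 : ℚ) + (a 2 : ℚ) - (a 3 : ℚ) + (a 5 : ℚ) - (a 7 : ℚ) := by exact_mod_cast Z1
  have Zr1 : (0 : ℝ) ≤ (a 1 : ℝ) + (a 2 : ℝ) - (a 3 : ℝ) + (a 5 : ℝ) - (a 7 : ℝ) := by exact_mod_cast Z1
  have Zq2 : (0 : ℚ) ≤ (a 5 : ℚ) := by exact_mod_cast Z2
  have Zr2 : (0 : ℝ) ≤ (a 5 : ℝ) := by exact_mod_cast Z2
  have Zq3 : (0 : ℚ) ≤ (a 1 : ℚ) + (a 2 : ℚ) + (a 5 : ℚ) - (a 7 : ℚ) := by exact_mod_cast Z3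
  have Zr3 : (0 : ℝ) ≤ (a 1 : ℝ) + (a 2 : ℝ) + (a 5 : ℝ) - (a 7 : ℝ) := by exact_mod_cast Z3
  have Zq4 : (0 : ℚ) ≤ (a 6 : ℚ) := by exact_mod_cast Z4
  have Zr4 : (0 : ℝ) ≤ (a 6 : ℝ) := by exact_mod_cast Z4
  have Zq5 : (0 : ℚ) ≤ (a 2 : ℚ) + (a 5 : ℚ) - (a 7 : ℚ) := by exact_mod_cast Z5
  have Zr5 : (0 : ℝ) ≤ (a 2 : ℝ) + (a 5 : ℝ) - (a 7 : ℝ) := by exact_mod_cast Z5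
  have Zq6 : (0 : ℚ) ≤ (a 0 : ℚ) + (a 1 : ℚ) - (a 3 : ℚ) + (a 5 : ℚ) - (a 7 : ℚ) := by exact_mod_cast Z6
  have Zr6 : (0 : ℝ) ≤ (a 0 : ℝ) + (a 1 : ℝ) - (a 3 : ℝ) + (a 5 : ℝ) - (a 7 : ℝ) := by exact_mod_cast Z6
  have Zq7 : (0 : ℚ) ≤ (a 3 : ℚ) := by exact_mod_cast Z7
  have Zr7 : (0 : ℝ) ≤ (a 3 : ℝ) := by exact_mod_cast Z7
  have Zq8 : (0 : ℚ) ≤ (a 4 : ℚ) := by exact_mod_cast Z8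
  have Zr8 : (0 : ℝ) ≤ (a 4 : ℝ) := by exact_mod_cast Z8
  have Zq9 : (0 : ℚ) ≤ (a 0 : ℚ) - (a 2 : ℚ) + (a 4 : ℚ) := by exact_mod_cast Z9
  have Zr9 : (0 : ℝ) ≤ (a 0 : ℝ) - (a 2 : ℝ) + (a 4 : ℝ) := by exact_mod_cast Z9
  have Zq10 : (0 : ℚ) ≤ (a 0 : ℚ) := by exact_mod_cast Z10
  have Zr10 : (0 : ℝ) ≤ (a 0 : ℝ) := by exact_mod_cast Z10
  have Zq11 : (0 : ℚ) ≤ (a 1 : ℚ) := by exact_mod_cast Z11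
  have Zr11 : (0 : ℝ) ≤ (a 1 : ℝ) := by exact_mod_cast Z11
  have Zq12 : (0 : ℚ) ≤ (a 6 : ℚ) - 1 := by exact_mod_cast Z12
  have Zr12 : (0 : ℝ) ≤ (a 6 : ℝ) - 1 := by exact_mod_cast Z12
  have Zq13 : (0 : ℚ) ≤ (a 1 : ℚ) + (a 2 : ℚ) - (a 3 : ℚ) + (a 5 : ℚ) - (a 7 : ℚ) + 1 := by exact_mod_cast Z13
  have Zr13 : (0 : ℝ) ≤ (a 1 : ℝ) + (a 2 : ℝ) - (a 3 : ℝ) + (a 5 : ℝ) - (a 7 : ℝ) + 1 := by exact_mod_cast Z13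
  have Zq14 : (0 : ℚ) ≤ (a 1 : ℚ) + (a 2 : ℚ) + (a 5 : ℚ) - (a 7 : ℚ) + 1 := by exact_mod_cast Z14
  have Zr14 : (0 : ℝ) ≤ (a 1 : ℝ) + (a 2 : ℝ) + (a 5 : ℝ) - (a 7 : ℝ) + 1 := by exact_mod_cast Z14
  have Zq15 : (0 : ℚ) ≤ (a 2 : ℚ) + (a 5 : ℚ) - (a 7 : ℚ) + 1 := by exact_mod_cast Z15
  have Zr15 : (0 : ℝ) ≤ (a 2 : ℝ) + (a 5 : ℝ) - (a 7 : ℝ) + 1 := by exact_mod_cast Z15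
  have Zq16 : (0 : ℚ) ≤ (a 0 : ℚ) + (a 1 : ℚ) - (a 3 : ℚ) + (a 5 : ℚ) - (a 7 : ℚ) + 1 := by exact_mod_cast Z16
  have Zr16 : (0 : ℝ) ≤ (a 0 : ℝ) + (a 1 : ℝ) - (a 3 : ℝ) + (a 5 : ℝ) - (a 7 : ℝ) + 1 := by exact_mod_cast Z16
  have Zq17 : (0 : ℚ) ≤ (a 0 : ℚ) + 1 := by exact_mod_cast Z17
  have Zr17 : (0 : ℝ) ≤ (a 0 : ℝ) + 1 := by exact_mod_cast Z17
  have Zq18 : (0 : ℚ) ≤ (a 3 : ℚ) + 1 := by exact_mod_cast Z18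
  have Zr18 : (0 : ℝ) ≤ (a 3 : ℝ) + 1 := by exact_mod_cast Z18
  have Zq19 : (0 : ℚ) ≤ (a 1 : ℚ) + 1 := by exact_mod_cast Z19
  have Zr19 : (0 : ℝ) ≤ (a 1 : ℝ) + 1 := by exact_mod_cast Z19
  obtain ⟨R0_0, R0_1, R0_2, R0_3, R0_4, R0_5, R0_6, R0_7, R0_8, R0_9⟩ := chamberQ_bounds hch0
  have Rq0_0 : (0 : ℚ) < (c₁ : ℚ) := by have h := R0_0; (try simp at h); linarith
  have Rr0_0 : (0 : ℝ) < (c₁ : ℝ) := by exact_mod_cast Rq0_0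
  have Rq0_1 : (c₁ : ℚ) < 1 + ((a 4 : ℚ) + (a 5 : ℚ) - (a 7 : ℚ)) := by have h := R0_1; (try simp at h); linarith
  have Rr0_1 : (c₁ : ℝ) < 1 + ((a 4 : ℝ) + (a 5 : ℝ) - (a 7 : ℝ)) := by exact_mod_cast Rq0_1
  have Rq0_2 : (c₁ : ℚ) < 1 + ((a 1 : ℚ) + (a 2 : ℚ) - (a 3 : ℚ) + (a 5 : ℚ) - (a 7 : ℚ)) := by have h := R0_2; (try simp at h); linarith
  have Rr0_2 : (c₁ : ℝ) < 1 + ((a 1 : ℝ) + (a 2 : ℝ) - (a 3 : ℝ) + (a 5 : ℝ) - (a 7 : ℝ)) := by exact_mod_cast Rq0_2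
  have Rq0_3 : (c₁ : ℚ) < 1 + ((a 5 : ℚ)) := by have h := R0_3; (try simp at h); linarith
  have Rr0_3 : (c₁ : ℝ) < 1 + ((a 5 : ℝ)) := by exact_mod_cast Rq0_3
  have Rq0_4 : (0 : ℚ) < (c₂ : ℚ) := by have h := R0_4; (try simp at h); linarith
  have Rr0_4 : (0 : ℝ) < (c₂ : ℝ) := by exact_mod_cast Rq0_4
  have Rq0_5 : (c₂ : ℚ) < 1 + ((a 6 : ℚ)) := by have h := R0_5; (try simp at h); linarith
  have Rr0_5 : (c₂ : ℝ) < 1 + ((a 6 : ℝ)) := by exact_mod_cast Rq0_5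
  have Rq0_6 : (c₂ : ℚ) < 1 + ((a 2 : ℚ) + (a 5 : ℚ) - (a 7 : ℚ)) := by have h := R0_6; (try simp at h); linarith
  have Rr0_6 : (c₂ : ℝ) < 1 + ((a 2 : ℝ) + (a 5 : ℝ) - (a 7 : ℝ)) := by exact_mod_cast Rq0_6
  have Rq0_7 : (c₂ : ℚ) < 1 + ((a 0 : ℚ) + (a 1 : ℚ) - (a 3 : ℚ) + (a 5 : ℚ) - (a 7 : ℚ)) := by have h := R0_7; (try simp at h); linarith
  have Rr0_7 : (c₂ : ℝ) < 1 + ((a 0 : ℝ) + (a 1 : ℝ) - (a 3 : ℝ) + (a 5 : ℝ) - (a 7 : ℝ)) := by exact_mod_cast Rq0_7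
  have Rq0_8 : (1 : ℚ) + ((a 4 : ℚ) + (a 5 : ℚ) - (a 7 : ℚ)) + ((a 0 : ℚ) + (a 1 : ℚ) - (a 3 : ℚ) + (a 5 : ℚ) - (a 7 : ℚ)) - ((a 0 : ℚ) - (a 2 : ℚ) + (a 4 : ℚ)) < (c₁ : ℚ) + (c₂ : ℚ) := by have h := R0_8; (try simp at h); linarith
  have Rr0_8 : (1 : ℝ) + ((a 4 : ℝ) + (a 5 : ℝ) - (a 7 : ℝ)) + ((a 0 : ℝ) + (a 1 : ℝ) - (a 3 : ℝ) + (a 5 : ℝ) - (a 7 : ℝ)) - ((a 0 : ℝ) - (a 2 : ℝ) + (a 4 : ℝ)) < (c₁ : ℝ) + (c₂ : ℝ) := by exact_mod_cast Rq0_8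
  have Rq0_9 : (c₁ : ℚ) + (c₂ : ℚ) < ((a 1 : ℚ) + (a 2 : ℚ) + (a 5 : ℚ) - (a 7 : ℚ)) + 2 := by have h := R0_9; (try simp at h); linarith
  have Rr0_9 : (c₁ : ℝ) + (c₂ : ℝ) < ((a 1 : ℝ) + (a 2 : ℝ) + (a 5 : ℝ) - (a 7 : ℝ)) + 2 := by exact_mod_cast Rq0_9
  obtain ⟨R1_0, R1_1, R1_2, R1_3, R1_4, R1_5, R1_6, R1_7, R1_8, R1_9⟩ := chamberQ_bounds hch1
  have Rq1_0 : (0 : ℚ) < (c₁ : ℚ) := by have h := R1_0; (try simp at h); linarith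
  have Rr1_0 : (0 : ℝ) < (c₁ : ℝ) := by exact_mod_cast Rq1_0
  have Rq1_1 : (c₁ : ℚ) < 1 + ((a 4 : ℚ) + (a 5 : ℚ) - (a 7 : ℚ)) := by have h := R1_1; (try simp at h); linarith
  have Rr1_1 : (c₁ : ℝ) < 1 + ((a 4 : ℝ) + (a 5 : ℝ) - (a 7 : ℝ)) := by exact_mod_cast Rq1_1
  have Rq1_2 : (c₁ : ℚ) < 1 + ((a 1 : ℚ) + (a 2 : ℚ) - (a 3 : ℚ) + (a 5 : ℚ) - (a 7 : ℚ)) := by have h := R1_2; (try simp at h); linarith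
  have Rr1_2 : (c₁ : ℝ) < 1 + ((a 1 : ℝ) + (a 2 : ℝ) - (a 3 : ℝ) + (a 5 : ℝ) - (a 7 : ℝ)) := by exact_mod_cast Rq1_2
  have Rq1_3 : (c₁ : ℚ) < 1 + ((a 5 : ℚ)) := by have h := R1_3; (try simp at h); linarith
  have Rr1_3 : (c₁ : ℝ) < 1 + ((a 5 : ℝ)) := by exact_mod_cast Rq1_3
  have Rq1_4 : (0 : ℚ) < (c₂ : ℚ) := by have h := R1_4; (try simp at h); linarith
  have Rr1_4 : (0 : ℝ) < (c₂ : ℝ) := by exact_mod_cast Rq1_4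
  have Rq1_5 : (c₂ : ℚ) < 1 + ((a 6 : ℚ) - 1) := by have h := R1_5; (try simp at h); linarith
  have Rr1_5 : (c₂ : ℝ) < 1 + ((a 6 : ℝ) - 1) := by exact_mod_cast Rq1_5
  have Rq1_6 : (c₂ : ℚ) < 1 + ((a 2 : ℚ) + (a 5 : ℚ) - (a 7 : ℚ)) := by have h := R1_6; (try simp at h); linarith
  have Rr1_6 : (c₂ : ℝ) < 1 + ((a 2 : ℝ) + (a 5 : ℝ) - (a 7 : ℝ)) := by exact_mod_cast Rq1_6
  have Rq1_7 : (c₂ : ℚ) < 1 + ((a 0 : ℚ) + (a 1 : ℚ) - (a 3 : ℚ) + (a 5 : ℚ) - (a 7 : ℚ)) := by have h := R1_7; (try simp at h); linarith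
  have Rr1_7 : (c₂ : ℝ) < 1 + ((a 0 : ℝ) + (a 1 : ℝ) - (a 3 : ℝ) + (a 5 : ℝ) - (a 7 : ℝ)) := by exact_mod_cast Rq1_7
  have Rq1_8 : (1 : ℚ) + ((a 4 : ℚ) + (a 5 : ℚ) - (a 7 : ℚ)) + ((a 0 : ℚ) + (a 1 : ℚ) - (a 3 : ℚ) + (a 5 : ℚ) - (a 7 : ℚ)) - ((a 0 : ℚ) - (a 2 : ℚ) + (a 4 : ℚ)) < (c₁ : ℚ) + (c₂ : ℚ) := by have h := R1_8; (try simp at h); linarith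
  have Rr1_8 : (1 : ℝ) + ((a 4 : ℝ) + (a 5 : ℝ) - (a 7 : ℝ)) + ((a 0 : ℝ) + (a 1 : ℝ) - (a 3 : ℝ) + (a 5 : ℝ) - (a 7 : ℝ)) - ((a 0 : ℝ) - (a 2 : ℝ) + (a 4 : ℝ)) < (c₁ : ℝ) + (c₂ : ℝ) := by exact_mod_cast Rq1_8
  have Rq1_9 : (c₁ : ℚ) + (c₂ : ℚ) < ((a 1 : ℚ) + (a 2 : ℚ) + (a 5 : ℚ) - (a 7 : ℚ)) + 2 := by have h := R1_9; (try simp at h); linarith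
  have Rr1_9 : (c₁ : ℝ) + (c₂ : ℝ) < ((a 1 : ℝ) + (a 2 : ℝ) + (a 5 : ℝ) - (a 7 : ℝ)) + 2 := by exact_mod_cast Rq1_9
  obtain ⟨R2_0, R2_1, R2_2, R2_3, R2_4, R2_5, R2_6, R2_7, R2_8, R2_9⟩ := chamberQ_bounds hch2
  have Rq2_0 : (0 : ℚ) < (c₁ : ℚ) := by have h := R2_0; (try simp at h); linarith
  have Rr2_0 : (0 : ℝ) < (c₁ : ℝ) := by exact_mod_cast Rq2_0
  have Rq2_1 : (c₁ : ℚ) < 1 + ((a 4 : ℚ) + (a 5 : ℚ) - (a 7 : ℚ)) := by have h := R2_1; (try simp at h); linarith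
  have Rr2_1 : (c₁ : ℝ) < 1 + ((a 4 : ℝ) + (a 5 : ℝ) - (a 7 : ℝ)) := by exact_mod_cast Rq2_1
  have Rq2_2 : (c₁ : ℚ) < 1 + ((a 1 : ℚ) + (a 2 : ℚ) - (a 3 : ℚ) + (a 5 : ℚ) - (a 7 : ℚ) + 1) := by have h := R2_2; (try simp at h); linarith
  have Rr2_2 : (c₁ : ℝ) < 1 + ((a 1 : ℝ) + (a 2 : ℝ) - (a 3 : ℝ) + (a 5 : ℝ) - (a 7 : ℝ) + 1) := by exact_mod_cast Rq2_2
  have Rq2_3 : (c₁ : ℚ) < 1 + ((a 5 : ℚ)) := by have h := R2_3; (try simp at h); linarith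
  have Rr2_3 : (c₁ : ℝ) < 1 + ((a 5 : ℝ)) := by exact_mod_cast Rq2_3
  have Rq2_4 : (0 : ℚ) < (c₂ : ℚ) := by have h := R2_4; (try simp at h); linarith
  have Rr2_4 : (0 : ℝ) < (c₂ : ℝ) := by exact_mod_cast Rq2_4
  have Rq2_5 : (c₂ : ℚ) < 1 + ((a 6 : ℚ)) := by have h := R2_5; (try simp at h); linarith
  have Rr2_5 : (c₂ : ℝ) < 1 + ((a 6 : ℝ)) := by exact_mod_cast Rq2_5
  have Rq2_6 : (c₂ : ℚ) < 1 + ((a 2 : ℚ) + (a 5 : ℚ) - (a 7 : ℚ) + 1) := by have h := R2_6; (try simp at h); linarith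
  have Rr2_6 : (c₂ : ℝ) < 1 + ((a 2 : ℝ) + (a 5 : ℝ) - (a 7 : ℝ) + 1) := by exact_mod_cast Rq2_6
  have Rq2_7 : (c₂ : ℚ) < 1 + ((a 0 : ℚ) + (a 1 : ℚ) - (a 3 : ℚ) + (a 5 : ℚ) - (a 7 : ℚ) + 1) := by have h := R2_7; (try simp at h); linarith
  have Rr2_7 : (c₂ : ℝ) < 1 + ((a 0 : ℝ) + (a 1 : ℝ) - (a 3 : ℝ) + (a 5 : ℝ) - (a 7 : ℝ) + 1) := by exact_mod_cast Rq2_7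
  have Rq2_8 : (1 : ℚ) + ((a 4 : ℚ) + (a 5 : ℚ) - (a 7 : ℚ)) + ((a 0 : ℚ) + (a 1 : ℚ) - (a 3 : ℚ) + (a 5 : ℚ) - (a 7 : ℚ) + 1) - ((a 0 : ℚ) - (a 2 : ℚ) + (a 4 : ℚ)) < (c₁ : ℚ) + (c₂ : ℚ) := by have h := R2_8; (try simp at h); linarith
  have Rr2_8 : (1 : ℝ) + ((a 4 : ℝ) + (a 5 : ℝ) - (a 7 : ℝ)) + ((a 0 : ℝ) + (a 1 : ℝ) - (a 3 : ℝ) + (a 5 : ℝ) - (a 7 : ℝ) + 1) - ((a 0 : ℝ) - (a 2 : ℝ) + (a 4 : ℝ)) < (c₁ : ℝ) + (c₂ : ℝ) := by exact_mod_cast Rq2_8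
  have Rq2_9 : (c₁ : ℚ) + (c₂ : ℚ) < ((a 1 : ℚ) + (a 2 : ℚ) + (a 5 : ℚ) - (a 7 : ℚ) + 1) + 2 := by have h := R2_9; (try simp at h); linarith
  have Rr2_9 : (c₁ : ℝ) + (c₂ : ℝ) < ((a 1 : ℝ) + (a 2 : ℝ) + (a 5 : ℝ) - (a 7 : ℝ) + 1) + 2 := by exact_mod_cast Rq2_9
  obtain ⟨R3_0, R3_1, R3_2, R3_3, R3_4, R3_5, R3_6, R3_7, R3_8, R3_9⟩ := chamberQ_bounds hch3
  have Rq3_0 : (0 : ℚ) < (c₁ : ℚ) := by have h := R3_0; (try simp at h); linarith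
  have Rr3_0 : (0 : ℝ) < (c₁ : ℝ) := by exact_mod_cast Rq3_0
  have Rq3_1 : (c₁ : ℚ) < 1 + ((a 4 : ℚ) + (a 5 : ℚ) - (a 7 : ℚ)) := by have h := R3_1; (try simp at h); linarith
  have Rr3_1 : (c₁ : ℝ) < 1 + ((a 4 : ℝ) + (a 5 : ℝ) - (a 7 : ℝ)) := by exact_mod_cast Rq3_1
  have Rq3_2 : (c₁ : ℚ) < 1 + ((a 1 : ℚ) + (a 2 : ℚ) - (a 3 : ℚ) + (a 5 : ℚ) - (a 7 : ℚ)) := by have h := R3_2; (try simp at h); linarith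
  have Rr3_2 : (c₁ : ℝ) < 1 + ((a 1 : ℝ) + (a 2 : ℝ) - (a 3 : ℝ) + (a 5 : ℝ) - (a 7 : ℝ)) := by exact_mod_cast Rq3_2
  have Rq3_3 : (c₁ : ℚ) < 1 + ((a 5 : ℚ)) := by have h := R3_3; (try simp at h); linarith
  have Rr3_3 : (c₁ : ℝ) < 1 + ((a 5 : ℝ)) := by exact_mod_cast Rq3_3
  have Rq3_4 : (0 : ℚ) < (c₂ : ℚ) := by have h := R3_4; (try simp at h); linarith
  have Rr3_4 : (0 : ℝ) < (c₂ : ℝ) := by exact_mod_cast Rq3_4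
  have Rq3_5 : (c₂ : ℚ) < 1 + ((a 6 : ℚ)) := by have h := R3_5; (try simp at h); linarith
  have Rr3_5 : (c₂ : ℝ) < 1 + ((a 6 : ℝ)) := by exact_mod_cast Rq3_5
  have Rq3_6 : (c₂ : ℚ) < 1 + ((a 2 : ℚ) + (a 5 : ℚ) - (a 7 : ℚ)) := by have h := R3_6; (try simp at h); linarith
  have Rr3_6 : (c₂ : ℝ) < 1 + ((a 2 : ℝ) + (a 5 : ℝ) - (a 7 : ℝ)) := by exact_mod_cast Rq3_6
  have Rq3_7 : (c₂ : ℚ) < 1 + ((a 0 : ℚ) + (a 1 : ℚ) - (a 3 : ℚ) + (a 5 : ℚ) - (a 7 : ℚ)) := by have h := R3_7; (try simp at h); linarith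
  have Rr3_7 : (c₂ : ℝ) < 1 + ((a 0 : ℝ) + (a 1 : ℝ) - (a 3 : ℝ) + (a 5 : ℝ) - (a 7 : ℝ)) := by exact_mod_cast Rq3_7
  have Rq3_8 : (1 : ℚ) + ((a 4 : ℚ) + (a 5 : ℚ) - (a 7 : ℚ)) + ((a 0 : ℚ) + (a 1 : ℚ) - (a 3 : ℚ) + (a 5 : ℚ) - (a 7 : ℚ)) - ((a 0 : ℚ) - (a 2 : ℚ) + (a 4 : ℚ)) < (c₁ : ℚ) + (c₂ : ℚ) := by have h := R3_8; (try simp at h); linarith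
  have Rr3_8 : (1 : ℝ) + ((a 4 : ℝ) + (a 5 : ℝ) - (a 7 : ℝ)) + ((a 0 : ℝ) + (a 1 : ℝ) - (a 3 : ℝ) + (a 5 : ℝ) - (a 7 : ℝ)) - ((a 0 : ℝ) - (a 2 : ℝ) + (a 4 : ℝ)) < (c₁ : ℝ) + (c₂ : ℝ) := by exact_mod_cast Rq3_8
  have Rq3_9 : (c₁ : ℚ) + (c₂ : ℚ) < ((a 1 : ℚ) + (a 2 : ℚ) + (a 5 : ℚ) - (a 7 : ℚ) + 1) + 2 := by have h := R3_9; (try simp at h); linarith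
  have Rr3_9 : (c₁ : ℝ) + (c₂ : ℝ) < ((a 1 : ℝ) + (a 2 : ℝ) + (a 5 : ℝ) - (a 7 : ℝ) + 1) + 2 := by exact_mod_cast Rq3_9
  have ZD0 : 0 ≤ a 3 - a 5 + a 7 := by
    have h : (-1 : ℚ) < (a 3 : ℚ) - (a 5 : ℚ) + (a 7 : ℚ) := by linarith
    have h' : (-1 : ℤ) < a 3 - a 5 + a 7 := by exact_mod_cast h
    omega
  have ZD3 : 0 ≤ a 3 - a 5 + a 7 + 1 := by
    have h : (-1 : ℚ) < (a 3 : ℚ) - (a 5 : ℚ) + (a 7 : ℚ) + 1 := by linarith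
    have h' : (-1 : ℤ) < a 3 - a 5 + a 7 + 1 := by exact_mod_cast h
    omega
  have I0 : cellularIntegral a = Jintegral ![a 4 + a 5 - a 7, a 1 + a 2 - a 3 + a 5 - a 7, a 5, a 1 + a 2 + a 5 - a 7, a 6, a 2 + a 5 - a 7, a 0 + a 1 - a 3 + a 5 - a 7] ![a 3, a 4, a 0 - a 2 + a 4, a 0, a 1] := by rw [h8 _ hc0, h10 _ hc0, eP0, eQ0]
  have I1 : cellularIntegral (a - slotDown 7) = Jintegral ![a 4 + a 5 - a 7, a 1 + a 2 - a 3 + a 5 - a 7, a 5, a 1 + a 2 + a 5 - a 7, a 6 - 1, a 2 + a 5 - a 7, a 0 + a 1 - a 3 + a 5 - a 7] ![a 3, a 4, a 0 - a 2 + a 4, a 0, a 1] := by rw [h8 _ hc1, h10 _ hc1, eP1, eQ1]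
  have I2 : cellularIntegral (a + halfUp457) = Jintegral ![a 4 + a 5 - a 7, a 1 + a 2 - a 3 + a 5 - a 7 + 1, a 5, a 1 + a 2 + a 5 - a 7 + 1, a 6, a 2 + a 5 - a 7 + 1, a 0 + a 1 - a 3 + a 5 - a 7 + 1] ![a 3, a 4, a 0 - a 2 + a 4, a 0 + 1, a 1] := by rw [h8 _ hc2, h10 _ hc2, eP2, eQ2]
  have I3 : cellularIntegral (a + dsUp) = Jintegral ![a 4 + a 5 - a 7, a 1 + a 2 - a 3 + a 5 - a 7, a 5, a 1 + a 2 + a 5 - a 7 + 1, a 6, a 2 + a 5 - a 7, a 0 + a 1 - a 3 + a 5 - a 7] ![a 3 + 1, a 4, a 0 - a 2 + a 4, a 0, a 1 + 1] := by rw [h8 _ hc3, h10 _ hc3, eP3, eQ3]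
  have M := jsum_of_kernel hF2 (Pv_bridge a) (Qv_bridge a) n1v_bridge n2v_bridge (κv_bridge a) c₁ c₂
    (by intro i j; fin_cases i <;> fin_cases j <;> simp [Pv_bridge] <;> omega)
    (by intro i j; fin_cases i <;> fin_cases j <;> simp [Qv_bridge] <;> omega)
    (by
      intro i; fin_cases i
      · simpa [Pv_bridge, Qv_bridge, n1v_bridge, n2v_bridge] using hch0
      · simpa [Pv_bridge, Qv_bridge, n1v_bridge, n2v_bridge] using hch1
      · simpa [Pv_bridge, Qv_bridge, n1v_bridge, n2v_bridge] using hch2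
      · simpa [Pv_bridge, Qv_bridge, n1v_bridge, n2v_bridge] using hch3
      · simp only [Pv_bridge, Qv_bridge, n1v_bridge, n2v_bridge, Matrix.cons_val_zero, Matrix.cons_val_succ, Matrix.cons_val_one, Matrix.head_cons]
        apply chamberQ_intro <;> simp <;> linarith
      · simp only [Pv_bridge, Qv_bridge, n1v_bridge, n2v_bridge, Matrix.cons_val_zero, Matrix.cons_val_succ, Matrix.cons_val_one, Matrix.head_cons]
        apply chamberQ_intro <;> simp <;> linarith
      · simp only [Pv_bridge, Qv_bridge, n1v_bridge, n2v_bridge, Matrix.cons_val_zero, Matrix.cons_val_succ, Matrix.cons_val_one, Matrix.head_cons]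
        apply chamberQ_intro <;> simp <;> linarith
      · simp only [Pv_bridge, Qv_bridge, n1v_bridge, n2v_bridge, Matrix.cons_val_zero, Matrix.cons_val_succ, Matrix.cons_val_one, Matrix.head_cons]
        apply chamberQ_intro <;> simp <;> linarith
      · simp only [Pv_bridge, Qv_bridge, n1v_bridge, n2v_bridge, Matrix.cons_val_zero, Matrix.cons_val_succ, Matrix.cons_val_one, Matrix.head_cons]
        apply chamberQ_intro <;> simp <;> linarith
      · simp only [Pv_bridge, Qv_bridge, n1v_bridge, n2v_bridge, Matrix.cons_val_zero, Matrix.cons_val_succ, Matrix.cons_val_one, Matrix.head_cons]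
        apply chamberQ_intro <;> simp <;> linarith
      · simp only [Pv_bridge, Qv_bridge, n1v_bridge, n2v_bridge, Matrix.cons_val_zero, Matrix.cons_val_succ, Matrix.cons_val_one, Matrix.head_cons]
        apply chamberQ_intro <;> simp <;> linarith
      · simp only [Pv_bridge, Qv_bridge, n1v_bridge, n2v_bridge, Matrix.cons_val_zero, Matrix.cons_val_succ, Matrix.cons_val_one, Matrix.head_cons]
        apply chamberQ_intro <;> simp <;> linarith)
    (by
      intro y
      exact kernel_bridge_sum a _ _ (by exact_mod_cast (show (a 3 - a 5 + a 7 + 1 : ℤ) ≠ 0 by omega)) (by exact_mod_cast (show (a 3 + 1 : ℤ) ≠ 0 by omega)) (by exact_mod_cast (show (a 1 + 1 : ℤ) ≠ 0 by omega)) (by exact_mod_cast (show (a 0 + 1 : ℤ) ≠ 0 by omega)) (by exact_mod_cast (show (a 0 + a 1 - a 3 + a 5 - a 7 + 1 : ℤ) ≠ 0 by omega)) (by apply ne_zero_of_re_ne; simp; first | done | (intro hc; linarith)) (by apply ne_zero_of_re_ne; simp; first | done | (intro hc; linarith)) (by apply ne_zero_of_re_ne; simp; first | done | (intro hc; linarith))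 (by apply ne_zero_of_re_ne; simp; first | done | (intro hc; linarith)) (by apply ne_zero_of_re_ne; simp; first | done | (intro hc; linarith)) (by apply ne_zero_of_re_ne; simp; first | done | (intro hc; linarith)) (by apply ne_zero_of_re_ne; simp; first | done | (intro hc; linarith)) (by apply ne_zero_of_re_ne; simp; first | done | (intro hc; linarith)) (by apply ne_zero_of_re_ne; simp; first | done | (intro hc; linarith)) (by apply ne_zero_of_re_ne; simp; first | done | (intro hc; linarith)) (by apply ne_zero_of_re_ne; simp; first | done | (intro hc; linarith)) (by apply ne_zero_of_re_ne; simp; first | done | (intro hc; linarith)) (by apply ne_zero_of_re_ne; simp; first | done | (intro hc; linarith)))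
  simp only [Fin.sum_univ_succ, Fin.sum_univ_zero, add_zero, Pv_bridge, Qv_bridge, κv_bridge,
    Matrix.cons_val_zero, Matrix.cons_val_succ] at M
  have K0 : (Complex.Gamma ((a 3 : ℂ) + 1) * Complex.Gamma ((a 4 : ℂ) + 1) * Complex.Gamma ((a 0 : ℂ) + 1) * Complex.Gamma ((a 1 : ℂ) + 1) / (Complex.Gamma ((a 4 : ℂ) + (a 5 : ℂ) - (a 7 : ℂ) + 1) * Complex.Gamma ((a 0 : ℂ) + (a 1 : ℂ) - (a 3 : ℂ) + (a 5 : ℂ) - (a 7 : ℂ) + 1) * Complex.Gamma ((a 3 : ℂ) - (a 5 : ℂ) + (a 7 : ℂ) + 1))) = (barnesPrefactor ![a 4 + a 5 - a 7, a 1 + a 2 - a 3 + a 5 - a 7, a 5, a 1 + a 2 + a 5 - a 7, a 6, a 2 + a 5 - a 7, a 0 + a 1 - a 3 + a 5 - a 7] ![a 3, a 4, a 0 - a 2 + a 4, a 0, a 1] : ℂ) := by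
    rw [barnesPrefactor_gamma' ![a 4 + a 5 - a 7, a 1 + a 2 - a 3 + a 5 - a 7, a 5, a 1 + a 2 + a 5 - a 7, a 6, a 2 + a 5 - a 7, a 0 + a 1 - a 3 + a 5 - a 7] ![a 3, a 4, a 0 - a 2 + a 4, a 0, a 1] (a 3) (a 4) (a 0) (a 1) (a 4 + a 5 - a 7) (a 0 + a 1 - a 3 + a 5 - a 7) (a 3 - a 5 + a 7)
      (by simp) (by simp) (by simp) (by simp) (by simp) (by simp) (by simp <;> omega)
      (by omega) (by omega) (by omega) (by omega) (by omega) (by omega) (by omega)]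
    push_cast; ring_nf
  have K2 : (Complex.Gamma ((a 3 : ℂ) + 1) * Complex.Gamma ((a 4 : ℂ) + 1) * Complex.Gamma ((a 0 : ℂ) + 2) * Complex.Gamma ((a 1 : ℂ) + 1) / (Complex.Gamma ((a 4 : ℂ) + (a 5 : ℂ) - (a 7 : ℂ) + 1) * Complex.Gamma ((a 0 : ℂ) + (a 1 : ℂ) - (a 3 : ℂ) + (a 5 : ℂ) - (a 7 : ℂ) + 2) * Complex.Gamma ((a 3 : ℂ) - (a 5 : ℂ) + (a 7 : ℂ) + 1))) = (barnesPrefactor ![a 4 + a 5 - a 7, a 1 + a 2 - a 3 + a 5 - a 7 + 1, a 5, a 1 + a 2 + a 5 - a 7 + 1, a 6, a 2 + a 5 - a 7 + 1, a 0 + a 1 - a 3 + a 5 - a 7 + 1] ![a 3, a 4, a 0 - a 2 + a 4, a 0 + 1, a 1] : ℂ) := by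
    rw [barnesPrefactor_gamma' ![a 4 + a 5 - a 7, a 1 + a 2 - a 3 + a 5 - a 7 + 1, a 5, a 1 + a 2 + a 5 - a 7 + 1, a 6, a 2 + a 5 - a 7 + 1, a 0 + a 1 - a 3 + a 5 - a 7 + 1] ![a 3, a 4, a 0 - a 2 + a 4, a 0 + 1, a 1] (a 3) (a 4) (a 0 + 1) (a 1) (a 4 + a 5 - a 7) (a 0 + a 1 - a 3 + a 5 - a 7 + 1) (a 3 - a 5 + a 7)
      (by simp) (by simp) (by simp) (by simp) (by simp) (by simp) (by simp <;> omega)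
      (by omega) (by omega) (by omega) (by omega) (by omega) (by omega) (by omega)]
    push_cast; ring_nf
  have K3 : (Complex.Gamma ((a 3 : ℂ) + 2) * Complex.Gamma ((a 4 : ℂ) + 1) * Complex.Gamma ((a 0 : ℂ) + 1) * Complex.Gamma ((a 1 : ℂ) + 2) / (Complex.Gamma ((a 4 : ℂ) + (a 5 : ℂ) - (a 7 : ℂ) + 1) * Complex.Gamma ((a 0 : ℂ) + (a 1 : ℂ) - (a 3 : ℂ) + (a 5 : ℂ) - (a 7 : ℂ) + 1) * Complex.Gamma ((a 3 : ℂ) - (a 5 : ℂ) + (a 7 : ℂ) + 2))) = (barnesPrefactor ![a 4 + a 5 - a 7, a 1 + a 2 - a 3 + a 5 - a 7, a 5, a 1 + a 2 + a 5 - a 7 + 1, a 6, a 2 + a 5 - a 7, a 0 + a 1 - a 3 + a 5 - a 7] ![a 3 + 1, a 4, a 0 - a 2 + a 4, a 0, a 1 + 1] : ℂ) := by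
    rw [barnesPrefactor_gamma' ![a 4 + a 5 - a 7, a 1 + a 2 - a 3 + a 5 - a 7, a 5, a 1 + a 2 + a 5 - a 7 + 1, a 6, a 2 + a 5 - a 7, a 0 + a 1 - a 3 + a 5 - a 7] ![a 3 + 1, a 4, a 0 - a 2 + a 4, a 0, a 1 + 1] (a 3 + 1) (a 4) (a 0) (a 1 + 1) (a 4 + a 5 - a 7) (a 0 + a 1 - a 3 + a 5 - a 7) (a 3 - a 5 + a 7 + 1)
      (by simp) (by simp) (by simp) (by simp) (by simp) (by simp) (by simp <;> omega)
      (by omega) (by omega) (by omega) (by omega) (by omega) (by omega) (by omega)]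
    push_cast; ring_nf
  have K4 : (Complex.Gamma ((a 3 : ℂ) + 2) * Complex.Gamma ((a 4 : ℂ) + 1) * Complex.Gamma ((a 0 : ℂ) + 2) * Complex.Gamma ((a 1 : ℂ) + 1) / (Complex.Gamma ((a 4 : ℂ) + (a 5 : ℂ) - (a 7 : ℂ) + 1) * Complex.Gamma ((a 0 : ℂ) + (a 1 : ℂ) - (a 3 : ℂ) + (a 5 : ℂ) - (a 7 : ℂ) + 2) * Complex.Gamma ((a 3 : ℂ) - (a 5 : ℂ) + (a 7 : ℂ) + 1))) = (barnesPrefactor ![a 4 + a 5 - a 7, a 1 + a 2 - a 3 + a 5 - a 7, a 5, a 1 + a 2 + a 5 - a 7 + 1, a 6, a 2 + a 5 - a 7 + 1, a 0 + a 1 - a 3 + a 5 - a 7 + 1] ![a 3 + 1, a 4, a 0 - a 2 + a 4, a 0 + 1, a 1] : ℂ) := by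
    rw [barnesPrefactor_gamma' ![a 4 + a 5 - a 7, a 1 + a 2 - a 3 + a 5 - a 7, a 5, a 1 + a 2 + a 5 - a 7 + 1, a 6, a 2 + a 5 - a 7 + 1, a 0 + a 1 - a 3 + a 5 - a 7 + 1] ![a 3 + 1, a 4, a 0 - a 2 + a 4, a 0 + 1, a 1] (a 3 + 1) (a 4) (a 0 + 1) (a 1) (a 4 + a 5 - a 7) (a 0 + a 1 - a 3 + a 5 - a 7 + 1) (a 3 - a 5 + a 7)
      (by simp) (by simp) (by simp) (by simp) (by simp) (by simp) (by simp <;> omega)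
      (by omega) (by omega) (by omega) (by omega) (by omega) (by omega) (by omega)]
    push_cast; ring_nf
  have K6 : (Complex.Gamma ((a 3 : ℂ) + 2) * Complex.Gamma ((a 4 : ℂ) + 1) * Complex.Gamma ((a 0 : ℂ) + 2) * Complex.Gamma ((a 1 : ℂ) + 1) / (Complex.Gamma ((a 4 : ℂ) + (a 5 : ℂ) - (a 7 : ℂ) + 1) * Complex.Gamma ((a 0 : ℂ) + (a 1 : ℂ) - (a 3 : ℂ) + (a 5 : ℂ) - (a 7 : ℂ) + 2) * Complex.Gamma ((a 3 : ℂ) - (a 5 : ℂ) + (a 7 : ℂ) + 2))) = (barnesPrefactor ![a 4 + a 5 - a 7, a 1 + a 2 - a 3 + a 5 - a 7, a 5, a 1 + a 2 + a 5 - a 7 + 2, a 6, a 2 + a 5 - a 7 + 1, a 0 + a 1 - a 3 + a 5 - a 7 + 1] ![a 3 + 1, a 4, a 0 - a 2 + a 4, a 0 + 1, a 1] : ℂ) := by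
    rw [barnesPrefactor_gamma' ![a 4 + a 5 - a 7, a 1 + a 2 - a 3 + a 5 - a 7, a 5, a 1 + a 2 + a 5 - a 7 + 2, a 6, a 2 + a 5 - a 7 + 1, a 0 + a 1 - a 3 + a 5 - a 7 + 1] ![a 3 + 1, a 4, a 0 - a 2 + a 4, a 0 + 1, a 1] (a 3 + 1) (a 4) (a 0 + 1) (a 1) (a 4 + a 5 - a 7) (a 0 + a 1 - a 3 + a 5 - a 7 + 1) (a 3 - a 5 + a 7 + 1)
      (by simp) (by simp) (by simp) (by simp) (by simp) (by simp) (by simp <;> omega)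
      (by omega) (by omega) (by omega) (by omega) (by omega) (by omega) (by omega)]
    push_cast; ring_nf
  have K8 : (Complex.Gamma ((a 3 : ℂ) + 2) * Complex.Gamma ((a 4 : ℂ) + 1) * Complex.Gamma ((a 0 : ℂ) + 1) * Complex.Gamma ((a 1 : ℂ) + 1) / (Complex.Gamma ((a 4 : ℂ) + (a 5 : ℂ) - (a 7 : ℂ) + 1) * Complex.Gamma ((a 0 : ℂ) + (a 1 : ℂ) - (a 3 : ℂ) + (a 5 : ℂ) - (a 7 : ℂ) + 2) * Complex.Gamma ((a 3 : ℂ) - (a 5 : ℂ) + (a 7 : ℂ) + 1))) = (barnesPrefactor ![a 4 + a 5 - a 7, a 1 + a 2 - a 3 + a 5 - a 7, a 5, a 1 + a 2 + a 5 - a 7 + 1, a 6 + 1, a 2 + a 5 - a 7 + 1, a 0 + a 1 - a 3 + a 5 - a 7 + 1] ![a 3 + 1, a 4, a 0 - a 2 + a 4, a 0, a 1] : ℂ) := by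
    rw [barnesPrefactor_gamma' ![a 4 + a 5 - a 7, a 1 + a 2 - a 3 + a 5 - a 7, a 5, a 1 + a 2 + a 5 - a 7 + 1, a 6 + 1, a 2 + a 5 - a 7 + 1, a 0 + a 1 - a 3 + a 5 - a 7 + 1] ![a 3 + 1, a 4, a 0 - a 2 + a 4, a 0, a 1] (a 3 + 1) (a 4) (a 0) (a 1) (a 4 + a 5 - a 7) (a 0 + a 1 - a 3 + a 5 - a 7 + 1) (a 3 - a 5 + a 7)
      (by simp) (by simp) (by simp) (by simp) (by simp) (by simp) (by simp <;> omega)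
      (by omega) (by omega) (by omega) (by omega) (by omega) (by omega) (by omega)]
    push_cast; ring_nf
  have K10 : (Complex.Gamma ((a 3 : ℂ) + 2) * Complex.Gamma ((a 4 : ℂ) + 1) * Complex.Gamma ((a 0 : ℂ) + 1) * Complex.Gamma ((a 1 : ℂ) + 1) / (Complex.Gamma ((a 4 : ℂ) + (a 5 : ℂ) - (a 7 : ℂ) + 1) * Complex.Gamma ((a 0 : ℂ) + (a 1 : ℂ) - (a 3 : ℂ) + (a 5 : ℂ) - (a 7 : ℂ) + 2) * Complex.Gamma ((a 3 : ℂ) - (a 5 : ℂ) + (a 7 : ℂ) + 2))) = (barnesPrefactor ![a 4 + a 5 - a 7, a 1 + a 2 - a 3 + a 5 - a 7, a 5, a 1 + a 2 + a 5 - a 7 + 2, a 6 + 1, a 2 + a 5 - a 7 + 1, a 0 + a 1 - a 3 + a 5 - a 7 + 1] ![a 3 + 1, a 4, a 0 - a 2 + a 4, a 0, a 1] : ℂ) := by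
    rw [barnesPrefactor_gamma' ![a 4 + a 5 - a 7, a 1 + a 2 - a 3 + a 5 - a 7, a 5, a 1 + a 2 + a 5 - a 7 + 2, a 6 + 1, a 2 + a 5 - a 7 + 1, a 0 + a 1 - a 3 + a 5 - a 7 + 1] ![a 3 + 1, a 4, a 0 - a 2 + a 4, a 0, a 1] (a 3 + 1) (a 4) (a 0) (a 1) (a 4 + a 5 - a 7) (a 0 + a 1 - a 3 + a 5 - a 7 + 1) (a 3 - a 5 + a 7 + 1)
      (by simp) (by simp) (by simp) (by simp) (by simp) (by simp) (by simp <;> omega)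
      (by omega) (by omega) (by omega) (by omega) (by omega) (by omega) (by omega)]
    push_cast; ring_nf
  rw [K0, K2, K3, K4, K6, K8, K10] at M
  have KK0 : (barnesPrefactor ![a 4 + a 5 - a 7, a 1 + a 2 - a 3 + a 5 - a 7, a 5, a 1 + a 2 + a 5 - a 7, a 6 - 1, a 2 + a 5 - a 7, a 0 + a 1 - a 3 + a 5 - a 7] ![a 3, a 4, a 0 - a 2 + a 4, a 0, a 1] : ℂ) = (barnesPrefactor ![a 4 + a 5 - a 7, a 1 + a 2 - a 3 + a 5 - a 7, a 5, a 1 + a 2 + a 5 - a 7, a 6, a 2 + a 5 - a 7, a 0 + a 1 - a 3 + a 5 - a 7] ![a 3, a 4, a 0 - a 2 + a 4, a 0, a 1] : ℂ) := by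
    simp [barnesPrefactor]
  rw [KK0] at M
  have hK0 : (barnesPrefactor ![a 4 + a 5 - a 7, a 1 + a 2 - a 3 + a 5 - a 7, a 5, a 1 + a 2 + a 5 - a 7, a 6, a 2 + a 5 - a 7, a 0 + a 1 - a 3 + a 5 - a 7] ![a 3, a 4, a 0 - a 2 + a 4, a 0, a 1] : ℂ) ≠ 0 := by exact_mod_cast (barnesPrefactor_pos _ _).ne'
  have hK2 : (barnesPrefactor ![a 4 + a 5 - a 7, a 1 + a 2 - a 3 + a 5 - a 7 + 1, a 5, a 1 + a 2 + a 5 - a 7 + 1, a 6, a 2 + a 5 - a 7 + 1, a 0 + a 1 - a 3 + a 5 - a 7 + 1] ![a 3, a 4, a 0 - a 2 + a 4, a 0 + 1, a 1] : ℂ) ≠ 0 := by exact_mod_cast (barnesPrefactor_pos _ _).ne'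
  have hK3 : (barnesPrefactor ![a 4 + a 5 - a 7, a 1 + a 2 - a 3 + a 5 - a 7, a 5, a 1 + a 2 + a 5 - a 7 + 1, a 6, a 2 + a 5 - a 7, a 0 + a 1 - a 3 + a 5 - a 7] ![a 3 + 1, a 4, a 0 - a 2 + a 4, a 0, a 1 + 1] : ℂ) ≠ 0 := by exact_mod_cast (barnesPrefactor_pos _ _).ne'
  have hK4 : (barnesPrefactor ![a 4 + a 5 - a 7, a 1 + a 2 - a 3 + a 5 - a 7, a 5, a 1 + a 2 + a 5 - a 7 + 1, a 6, a 2 + a 5 - a 7 + 1, a 0 + a 1 - a 3 + a 5 - a 7 + 1] ![a 3 + 1, a 4, a 0 - a 2 + a 4, a 0 + 1, a 1] : ℂ) ≠ 0 := by exact_mod_cast (barnesPrefactor_pos _ _).ne'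
  have hK6 : (barnesPrefactor ![a 4 + a 5 - a 7, a 1 + a 2 - a 3 + a 5 - a 7, a 5, a 1 + a 2 + a 5 - a 7 + 2, a 6, a 2 + a 5 - a 7 + 1, a 0 + a 1 - a 3 + a 5 - a 7 + 1] ![a 3 + 1, a 4, a 0 - a 2 + a 4, a 0 + 1, a 1] : ℂ) ≠ 0 := by exact_mod_cast (barnesPrefactor_pos _ _).ne'
  have hK8 : (barnesPrefactor ![a 4 + a 5 - a 7, a 1 + a 2 - a 3 + a 5 - a 7, a 5, a 1 + a 2 + a 5 - a 7 + 1, a 6 + 1, a 2 + a 5 - a 7 + 1, a 0 + a 1 - a 3 + a 5 - a 7 + 1] ![a 3 + 1, a 4, a 0 - a 2 + a 4, a 0, a 1] : ℂ) ≠ 0 := by exact_mod_cast (barnesPrefactor_pos _ _).ne'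
  have hK10 : (barnesPrefactor ![a 4 + a 5 - a 7, a 1 + a 2 - a 3 + a 5 - a 7, a 5, a 1 + a 2 + a 5 - a 7 + 2, a 6 + 1, a 2 + a 5 - a 7 + 1, a 0 + a 1 - a 3 + a 5 - a 7 + 1] ![a 3 + 1, a 4, a 0 - a 2 + a 4, a 0, a 1] : ℂ) ≠ 0 := by exact_mod_cast (barnesPrefactor_pos _ _).ne'
  simp only [mul_div_assoc, div_self hK0, div_self hK2, div_self hK3, div_self hK4, div_self hK6, div_self hK8, div_self hK10, mul_one] at M
  have C0 : ((bridgeBase (bOfA a) : ℤ) : ℂ) = (((a 3 : ℂ) - (a 5 : ℂ) + (a 6 : ℂ) + (a 7 : ℂ) + 1) * ((a 0 : ℂ) - (a 3 : ℂ) + (a 6 : ℂ))) := by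
    simp [bridgeBase, bOfA, -mul_eq_mul_left_iff, -mul_eq_mul_right_iff]
    all_goals (first | done | ring | (push_cast; ring))
  have C1 : ((bridgeSlot (bOfA a) : ℤ) : ℂ) = (-((-(a 5 : ℂ) + (a 6 : ℂ) + (a 7 : ℂ)) * ((a 6 : ℂ)))) := by
    simp [bridgeSlot, bOfA, -mul_eq_mul_left_iff, -mul_eq_mul_right_iff]
    all_goals (first | done | ring | (push_cast; ring))
  have C2 : ((bridgeHalf (bOfA a) : ℤ) : ℂ) = (((a 3 : ℂ) - (a 5 : ℂ) + (a 6 : ℂ) + (a 7 : ℂ) + 1) * ((a 0 : ℂ) + (a 1 : ℂ) - (a 3 : ℂ) + (a 5 : ℂ) - (a 7 : ℂ) + 1)) := by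
    simp [bridgeHalf, bOfA, -mul_eq_mul_left_iff, -mul_eq_mul_right_iff]
    all_goals (first | done | ring | (push_cast; ring))
  have C3 : ((bridgeApex (bOfA a) : ℤ) : ℂ) = ((-(a 0 : ℂ) + (a 2 : ℂ) + (a 3 : ℂ) + 1) * ((a 3 : ℂ) - (a 5 : ℂ) + (a 7 : ℂ) + 1)) := by
    simp [bridgeApex, bOfA, -mul_eq_mul_left_iff, -mul_eq_mul_right_iff]
    all_goals (first | done | ring | (push_cast; ring))
  have goalS : ((((a 3 : ℤ) : ℂ)) + 1) * (((bridgeBase (bOfA a) : ℤ) : ℂ) * ((Jintegral ![a 4 + a 5 - a 7, a 1 + a 2 - a 3 + a 5 - a 7, a 5, a 1 + a 2 + a 5 - a 7, a 6, a 2 + a 5 - a 7, a 0 + a 1 - a 3 + a 5 - a 7] ![a 3, a 4, a 0 - a 2 + a 4, a 0, a 1] : ℝ) : ℂ) + ((bridgeSlot (bOfA a) : ℤ) : ℂ) * ((Jintegral ![a 4 + a 5 - a 7, a 1 + a 2 - a 3 + a 5 - a 7, a 5, a 1 + a 2 + a 5 - a 7, a 6 - 1, a 2 + a 5 - a 7,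 a 0 + a 1 - a 3 + a 5 - a 7] ![a 3, a 4, a 0 - a 2 + a 4, a 0, a 1] : ℝ) : ℂ) + ((bridgeHalf (bOfA a) : ℤ) : ℂ) * ((Jintegral ![a 4 + a 5 - a 7, a 1 + a 2 - a 3 + a 5 - a 7 + 1, a 5, a 1 + a 2 + a 5 - a 7 + 1, a 6, a 2 + a 5 - a 7 + 1, a 0 + a 1 - a 3 + a 5 - a 7 + 1] ![a 3, a 4, a 0 - a 2 + a 4, a 0 + 1, a 1] : ℝ) : ℂ) + ((bridgeApex (bOfA a) : ℤ) : ℂ) * ((Jintegral ![a 4 + a 5 - a 7, a 1 + a 2 - a 3 + a 5 - a 7, a 5, a 1 + a 2 + a 5 - a 7 + 1, a 6, a 2 + a 5 - a 7, a 0 + a 1 - a 3 + a 5 - a 7] ![a 3 + 1, a 4, a 0 - a 2 + a 4, a 0, a 1 + 1] : ℝ) : ℂ)) = 0 := by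
    rw [C0, C1, C2, C3]
    linear_combination M
  have hne : ((((a 3 : ℤ) : ℂ)) + 1) ≠ 0 := by exact_mod_cast (show ((a 3 : ℤ) + 1 : ℤ) ≠ 0 by omega)
  have goalC := (mul_eq_zero.mp goalS).resolve_left hne
  unfold FourTermRel
  rw [I0, I1, I2, I3]
  exact_mod_cast goalC

end Summit.KontsevichZagierPeriods.Zeta5Search.WedgeDictionary.KernelCells
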